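import Literature.AlgebraicGeometry.Motives.FrobIntegralPartTopIffFrobeniusSemisimple
import HarnessLib

/-!
# `F^•_b Hⁱ(X)` decreases in `r`, and `F^0_b Hⁱ(X)` is the largest `ϖ`-stable subspace of `Hⁱ(X)`
# on which the Frobenius is semisimple (Milne–Ramachandran 2006, §1.1 and Rem. 1.4)

Topic `Literature/AlgebraicGeometry/Motives`; THEOREMS ONLY (no definition, no instance, no named
fact; D-0026).

J. S. Milne, N. Ramachandran, *Motivic complexes over finite fields and the ring of correspondences at
the generic point*, arXiv:math/0607483 [MilneRamachandran2006] §1 (held text, chunk p0003):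
§1.1 (L31–L45) «When the eigenvalues are all […] algebraic integers, resp. semisimple, we say that `V`
is […] effective, resp. semisimple. For example, for any smooth complete variety `X` over `k`,
`Hⁱ_l(X)` is an effective Tate structure of weight `i/2` ([deligne1980])»; Rem. 1.4 (L77–L88)
«`F^r_b Hⁱ_l(X)` […] is the largest semisimple Tate substructure of `Hⁱ_l(X)` whose twist by `ℚ_l(r)`
is STILL effective».

Two readings of these sentences for the tree's `E.frobIntegralPart X i r = F^r_b Hⁱ(X)`
(`Motives/GeneralizedTateConjecture`; `ϖ = E.frobenius X i = E.frobAction X i`,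
`ϖ_r = (q⁻¹)^r • ϖ`), proved for the abstract `E : GaloisWeilCohomology k K χ` over a finite field `k`
and `X` smooth projective:

* §1 **«still effective»: `F^{r+1}_b Hⁱ(X) ⊆ F^r_b Hⁱ(X)`**, i.e. `r ↦ F^r_b Hⁱ(X)` is ANTITONE
  (`IsEffectiveTwistSubspace.of_succ`, `frobIntegralPart_succ_le`, `frobIntegralPart_antitone`): if
  `ϖ_{r+1} = q⁻¹ ϖ_r` is semisimple with algebraic-integer eigenvalues on `V`, so is `ϖ_r = q ϖ_{r+1}`
  (the monic integer polynomial `Q(T/q) q^{deg Q}` — `Polynomial.scaleRoots` — kills it; a squarefree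
  one then exists by row g39-#10's `exists_monic_squarefree_aeval_eq_zero_of_isSemisimple`).  Hence
  `𝒯ʳ(X) ⊆ F^s_b H^{2r}(X)` for all `s ≤ r` (`tateClasses_le_frobIntegralPart_of_le`).
* §2 **«`Hⁱ_l(X)` is effective» + «largest semisimple»: given an integral model of `P_i(X, T)`,
  `F^0_b Hⁱ(X)` is the LARGEST `ϖ`-stable subspace of `Hⁱ(X)` on which `ϖ` acts semisimply**
  (`le_frobIntegralPart_zero_iff`: for a `ϖ`-stable `V`, `V ⊆ F^0_b Hⁱ(X) ⟺ ϖ|_V` is semisimple),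
  with the two directions `le_frobIntegralPart_zero_of_isSemisimple_restrict` (Cayley–Hamilton: the
  integral characteristic polynomial kills `ϖ|_V`) and `isSemisimple_restrict_of_le_frobIntegralPart`
  (any `r`, no integrality needed: one polynomial squarefree over `ℚ` kills `ϖ_r` on `F_b`, row g39-#9).

HC is not touched.

## References

* [MilneRamachandran2006] J. S. Milne, N. Ramachandran, arXiv:math/0607483, §1.1 and Rem. 1.4.
* [Deligne1974] P. Deligne, *La conjecture de Weil. I*, Thm. (1.6) (integrality of the eigenvalues).
* [Milne2007TateFiniteFieldsAIM] J. S. Milne, arXiv:0709.3040, §1 (Tate classes over `𝔽`).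

## Provenance

Lane `lit-hodgefound` (summit `HodgeConjecture`, Track 2 foundations library, Layer B: motives),
seat `lit-hodgefound-p29` (literature-prover, generation 39, row g39-#11).
-/

noncomputable section

open Polynomial

universe u v

namespace Literature.AlgebraicGeometry.Motives

namespace GaloisWeilCohomology

variable {k : Type u} [Field k] [Finite k] {K : Type v} [Field K] [CharZero K]
  {χ : Field.absoluteGaloisGroup k →* Kˣ} (E : GaloisWeilCohomology k K χ)
variable {d : ℕ} {X : SchemeOver k}

omit [CharZero K] in
/-- A polynomial in the restriction of an endomorphism to a stable subspace, on elements (private copy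
of the tree's `coe_aeval_restrict_apply`,
`HodgeTheory/AbelianVarietyCyclotomicAutomorphismIntegralFreeLattice`, not imported here). [folklore] -/
private theorem coe_aeval_restrict_apply' {V : Type*} [AddCommGroup V] [Module K V]
    {f : Module.End K V} {p : Submodule K V} (hf : ∀ x ∈ p, f x ∈ p) (P : K[X]) (v : p) :
    ((aeval (f.restrict hf) P) v : V) = aeval f P (v : V) := by
  induction P using Polynomial.induction_on' with
  | add P Q hP hQ => simp only [map_add, LinearMap.add_apply, Submodule.coe_add, hP, hQ]
  | monomial n a =>
    simp only [aeval_monomial, LinearMap.smul_apply, Submodule.coe_smul, ← Algebra.smul_def,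
      Module.End.pow_restrict n hf, LinearMap.coe_restrict_apply]

/-- Bookkeeping: `(Q ⊗ ℚ) ⊗ K = Q ⊗ K`. [folklore] -/
private theorem map_map_intCast_ratCast' (Q : ℤ[X]) :
    (Q.map (Int.castRingHom ℚ)).map (algebraMap ℚ K) = Q.map (Int.castRingHom K) := by
  rw [Polynomial.map_map]
  congr 1
  exact RingHom.ext_int _ _

/-- A `ϖ`-stable subspace is `ϖ_r`-stable. [cite: MilneRamachandran2006, §1 Rem. 1.4] -/
theorem smul_frobenius_apply_mem {i : ℕ} {V : Submodule K (E.obj X i)}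
    (hV : ∀ v ∈ V, E.frobenius X i v ∈ V) (r : ℕ) :
    ∀ v ∈ V, (((Nat.card k : K)⁻¹ ^ r) • E.frobenius X i) v ∈ V :=
  fun v hv ↦ by rw [LinearMap.smul_apply]; exact Submodule.smul_mem _ _ (hV v hv)

/-! ### §1 «still effective»: `F^{r+1}_b Hⁱ(X) ⊆ F^r_b Hⁱ(X)` -/

/-- `ϖ_r = q • ϖ_{r+1}`. [cite: MilneRamachandran2006, §1 Rem. 1.4] -/
theorem smul_frobenius_eq_card_smul_succ (X : SchemeOver k) (i r : ℕ) :
    ((Nat.card k : K)⁻¹ ^ r) • E.frobenius X i =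
      (Nat.card k : K) • (((Nat.card k : K)⁻¹ ^ (r + 1)) • E.frobenius X i) := by
  have hq : (Nat.card k : K) ≠ 0 := by exact_mod_cast Nat.card_pos.ne'
  rw [smul_smul, pow_succ, ← mul_assoc, mul_comm (Nat.card k : K), mul_assoc, mul_inv_cancel₀ hq,
    mul_one]

variable {E} in
/-- **An effective-twist subspace for `r + 1` is one for `r`** (`X` smooth projective): on `V`,
`ϖ_{r+1}` is semisimple (killed by a squarefree polynomial) with algebraic-integer eigenvalues (killed
by the monic integer `Q`), so `ϖ_r = q ϖ_{r+1}` is semisimple and killed by the monic integer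
`scaleRoots Q q`; a monic integer annihilator squarefree over `ℚ` then exists (radical, Gauss's lemma).
Rem. 1.4: «whose twist by `ℚ_l(r)` is STILL effective». [cite: MilneRamachandran2006, §1.1 and Rem. 1.4] -/
theorem IsEffectiveTwistSubspace.of_succ (hX : IsSmoothProjective d X) {i r : ℕ}
    {V : Submodule K (E.obj X i)} (hV : E.IsEffectiveTwistSubspace X i (r + 1) V) :
    E.IsEffectiveTwistSubspace X i r V := by
  haveI := E.finite_obj hX i
  have hst := hV.1
  obtain ⟨Q, hQm, hQs, hQ⟩ := hV.2
  have hq : (Nat.card k : K) ≠ 0 := by exact_mod_cast Nat.card_pos.ne'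
  -- the restrictions `g = ϖ_{r+1}|_V`, `g' = ϖ_r|_V = q • g`
  set f₁ := ((Nat.card k : K)⁻¹ ^ (r + 1)) • E.frobenius X i with hf₁
  set f₀ := ((Nat.card k : K)⁻¹ ^ r) • E.frobenius X i with hf₀
  have hV₁ : ∀ v ∈ V, f₁ v ∈ V := E.smul_frobenius_apply_mem hst (r + 1)
  have hV₀ : ∀ v ∈ V, f₀ v ∈ V := E.smul_frobenius_apply_mem hst r
  set g := f₁.restrict hV₁ with hg
  set g' := f₀.restrict hV₀ with hg'
  have hgg' : g' = (Nat.card k : K) • g := by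
    ext ⟨v, hv⟩
    simp only [hg, hg', LinearMap.coe_restrict_apply, LinearMap.smul_apply, Submodule.coe_smul,
      hf₀, hf₁, E.smul_frobenius_eq_card_smul_succ X i r]
  -- `g` is killed by `Q`, hence semisimple; `g'` is semisimple
  have hgQ : aeval g (Q.map (Int.castRingHom K)) = 0 := by
    ext ⟨v, hv⟩
    rw [LinearMap.zero_apply, Submodule.coe_zero, coe_aeval_restrict_apply']
    exact hQ v hv
  have hgss : Module.End.IsSemisimple g := by
    refine Module.End.isSemisimple_of_squarefree_aeval_eq_zero (p := Q.map (Int.castRingHom K)) ?_ hgQ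
    rw [← map_map_intCast_ratCast']
    exact ((PerfectField.separable_iff_squarefree.mpr hQs).map).squarefree
  have hg'ss : Module.End.IsSemisimple g' := by
    rw [hgg']; exact Module.End.IsSemisimple_smul _ hgss
  -- `g'` is killed by the monic integer polynomial `scaleRoots Q q`
  have hQ'm : (Q.scaleRoots (Nat.card k : ℤ)).Monic := (monic_scaleRoots_iff _).mpr hQm
  have hg'Q : aeval g' ((Q.scaleRoots (Nat.card k : ℤ)).map (Int.castRingHom K)) = 0 := by
    have hmap : (Q.scaleRoots (Nat.card k : ℤ)).map (Int.castRingHom K) =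
        (Q.map (Int.castRingHom K)).scaleRoots (Nat.card k : K) := by
      rw [map_scaleRoots _ _ _ (by rw [hQm.leadingCoeff, map_one]; exact one_ne_zero)]
      simp
    rw [hmap, hgg', Algebra.smul_def]
    exact scaleRoots_aeval_eq_zero hgQ
  -- a squarefree one
  obtain ⟨Q', hQ'm', hQ's, hQ'⟩ :=
    exists_monic_squarefree_aeval_eq_zero_of_isSemisimple g' hg'ss hQ'm hg'Q
  refine ⟨hst, ⟨Q', hQ'm', hQ's, fun v hv ↦ ?_⟩⟩
  have h := congrArg (fun φ : Module.End K V ↦ ((φ ⟨v, hv⟩ : V) : E.obj X i)) hQ'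
  simpa only [hg', hf₀, LinearMap.zero_apply, Submodule.coe_zero, coe_aeval_restrict_apply']
    using h

/-- **`F^{r+1}_b Hⁱ(X) ⊆ F^r_b Hⁱ(X)`** (`X` smooth projective). [cite: MilneRamachandran2006, §1 Rem. 1.4] -/
theorem frobIntegralPart_succ_le (hX : IsSmoothProjective d X) (i r : ℕ) :
    E.frobIntegralPart X i (r + 1) ≤ E.frobIntegralPart X i r := by
  unfold frobIntegralPart
  exact iSup₂_le fun V hV ↦ E.le_frobIntegralPart (hV.of_succ hX)

/-- **`r ↦ F^r_b Hⁱ(X)` is antitone** (a decreasing filtration of `Hⁱ(X)`, like the coniveau filtration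
`F^r_a`, the tree's `coniveauFiltration_antitone`); `X` smooth projective.
[cite: MilneRamachandran2006, §1 Rem. 1.4] -/
theorem frobIntegralPart_antitone (hX : IsSmoothProjective d X) (i : ℕ) :
    Antitone (E.frobIntegralPart X i) :=
  antitone_nat_of_succ_le fun r ↦ E.frobIntegralPart_succ_le hX i r

/-- `F^r_b Hⁱ(X) ⊆ F^0_b Hⁱ(X)`. [cite: MilneRamachandran2006, §1 Rem. 1.4] -/
theorem frobIntegralPart_le_frobIntegralPart_zero (hX : IsSmoothProjective d X) (i r : ℕ) :
    E.frobIntegralPart X i r ≤ E.frobIntegralPart X i 0 :=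
  E.frobIntegralPart_antitone hX i (Nat.zero_le r)

/-- **Tate classes lie in every `F^s_b H^{2r}(X)`, `s ≤ r`** (`χ(φ) = q`; `X` smooth projective; row
g39-#8 `tateClasses_le_frobIntegralPart` and antitonicity).
[cite: MilneRamachandran2006, §1 Rem. 1.4 and Ex. 1.5] [cite: Milne2007TateFiniteFieldsAIM, §1] -/
theorem tateClasses_le_frobIntegralPart_of_le (hχ : ((χ (arithFrob k) : Kˣ) : K) = Nat.card k)
    (hX : IsSmoothProjective d X) {r s : ℕ} (hs : s ≤ r) :
    E.tateClasses X r ≤ E.frobIntegralPart X (2 * r) s :=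
  (E.tateClasses_le_frobIntegralPart hχ X r).trans (E.frobIntegralPart_antitone hX (2 * r) hs)

/-! ### §2 `F^0_b Hⁱ(X)` is the largest `ϖ`-stable subspace with semisimple Frobenius -/

/-- **Any `r`: `ϖ_r` is semisimple on every `ϖ`-stable subspace of `F^r_b Hⁱ(X)`** (`X` smooth
projective; ONE polynomial squarefree over `ℚ` kills `ϖ_r` on `F_b`, row g39-#9).
[cite: MilneRamachandran2006, §1.1 and Rem. 1.4] -/
theorem isSemisimple_restrict_smul_frobenius_of_le_frobIntegralPart (hX : IsSmoothProjective d X)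
    {i r : ℕ} {V : Submodule K (E.obj X i)} (hle : V ≤ E.frobIntegralPart X i r)
    (hV : ∀ v ∈ V, (((Nat.card k : K)⁻¹ ^ r) • E.frobenius X i) v ∈ V) :
    Module.End.IsSemisimple ((((Nat.card k : K)⁻¹ ^ r) • E.frobenius X i).restrict hV) := by
  obtain ⟨Q, -, hQs, hQ⟩ := E.exists_monic_squarefree_aeval_eq_zero_on_frobIntegralPart hX i r
  refine Module.End.isSemisimple_of_squarefree_aeval_eq_zero (p := Q.map (Int.castRingHom K)) ?_ ?_
  · rw [← map_map_intCast_ratCast']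
    exact ((PerfectField.separable_iff_squarefree.mpr hQs).map).squarefree
  · ext ⟨v, hv⟩
    rw [LinearMap.zero_apply, Submodule.coe_zero, coe_aeval_restrict_apply']
    exact hQ v (hle hv)

/-- **`ϖ` is semisimple on every `ϖ`-stable subspace of `F^r_b Hⁱ(X)`** (`X` smooth projective).
[cite: MilneRamachandran2006, §1.1 and Rem. 1.4] -/
theorem isSemisimple_restrict_of_le_frobIntegralPart (hX : IsSmoothProjective d X) {i r : ℕ}
    {V : Submodule K (E.obj X i)} (hle : V ≤ E.frobIntegralPart X i r)
    (hV : ∀ v ∈ V, E.frobenius X i v ∈ V) :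
    Module.End.IsSemisimple ((E.frobenius X i).restrict hV) := by
  have hq : ((Nat.card k : K)⁻¹ ^ r) ≠ 0 :=
    pow_ne_zero _ (inv_ne_zero (by exact_mod_cast Nat.card_pos.ne'))
  have h := E.isSemisimple_restrict_smul_frobenius_of_le_frobIntegralPart hX hle
    (E.smul_frobenius_apply_mem hV r)
  have hres : (((Nat.card k : K)⁻¹ ^ r) • E.frobenius X i).restrict (E.smul_frobenius_apply_mem hV r) =
      ((Nat.card k : K)⁻¹ ^ r) • (E.frobenius X i).restrict hV := by
    ext ⟨v, hv⟩; rfl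
  rw [hres, Module.End.IsSemisimple_smul_iff hq] at h
  exact h

/-- **«`Hⁱ_l(X)` is effective»: every `ϖ`-stable subspace on which `ϖ` is semisimple lies in
`F^0_b Hⁱ(X)`**, given an integral model of `P_i(X, T)` (`X` smooth projective): the monic integral
characteristic polynomial kills `ϖ|_V` (Cayley–Hamilton), and a squarefree one then exists.
[cite: MilneRamachandran2006, §1.1 and Rem. 1.4] [cite: Deligne1974, Thm. (1.6)] -/
theorem le_frobIntegralPart_zero_of_isSemisimple_restrict (hX : IsSmoothProjective d X) {i : ℕ}
    {P : ℤ[X]} (hP : E.IsIntegralModel X i P) {V : Submodule K (E.obj X i)}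
    (hV : ∀ v ∈ V, E.frobenius X i v ∈ V)
    (hss : Module.End.IsSemisimple ((E.frobenius X i).restrict hV)) :
    V ≤ E.frobIntegralPart X i 0 := by
  haveI := E.finite_obj hX i
  obtain ⟨R, hRm, hR⟩ := E.exists_monic_map_eq_charpoly_frobAction hX hP
  -- `R(ϖ) = 0`, hence `R(ϖ|_V) = 0`
  have hRϖ : aeval (E.frobenius X i) (R.map (Int.castRingHom K)) = 0 := by
    rw [hR, frobenius_eq_frobAction]; exact LinearMap.aeval_self_charpoly _
  have hRg : aeval ((E.frobenius X i).restrict hV) (R.map (Int.castRingHom K)) = 0 := by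
    ext ⟨v, hv⟩
    rw [LinearMap.zero_apply, Submodule.coe_zero, coe_aeval_restrict_apply', hRϖ,
      LinearMap.zero_apply]
  obtain ⟨Q, hQm, hQs, hQ⟩ :=
    exists_monic_squarefree_aeval_eq_zero_of_isSemisimple _ hss hRm hRg
  refine E.le_frobIntegralPart ⟨hV, ⟨Q, hQm, hQs, fun v hv ↦ ?_⟩⟩
  rw [pow_zero, one_smul]
  have h := congrArg (fun φ : Module.End K V ↦ ((φ ⟨v, hv⟩ : V) : E.obj X i)) hQ
  simpa only [LinearMap.zero_apply, Submodule.coe_zero, coe_aeval_restrict_apply'] using h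

/-- **REM. 1.4 for `r = 0`: `F^0_b Hⁱ(X)` is the LARGEST `ϖ`-stable subspace of `Hⁱ(X)` on which the
Frobenius acts semisimply** — for a `ϖ`-stable `V`: `V ⊆ F^0_b Hⁱ(X) ⟺ ϖ|_V` is semisimple (`X`
smooth projective with an integral model of `P_i(X, T)`, e.g. under the Riemann hypothesis).
[cite: MilneRamachandran2006, §1.1 and Rem. 1.4] [cite: Deligne1974, Thm. (1.6)] -/
theorem le_frobIntegralPart_zero_iff (hX : IsSmoothProjective d X) {i : ℕ} {P : ℤ[X]}
    (hP : E.IsIntegralModel X i P) {V : Submodule K (E.obj X i)}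
    (hV : ∀ v ∈ V, E.frobenius X i v ∈ V) :
    V ≤ E.frobIntegralPart X i 0 ↔ Module.End.IsSemisimple ((E.frobenius X i).restrict hV) :=
  ⟨fun h ↦ E.isSemisimple_restrict_of_le_frobIntegralPart hX h hV,
    E.le_frobIntegralPart_zero_of_isSemisimple_restrict hX hP hV⟩

/-- The same under the Riemann hypothesis for `X` (which supplies the integral model; degrees
`i > 2 dim X` are trivial). [cite: MilneRamachandran2006, §1.1 and Rem. 1.4] [cite: Deligne1974, Thm. (1.6)] -/
theorem le_frobIntegralPart_zero_iff_of_weilRiemannHypothesis (hX : IsSmoothProjective d X)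
    (hRH : E.WeilRiemannHypothesisFor X d) {i : ℕ} {V : Submodule K (E.obj X i)}
    (hV : ∀ v ∈ V, E.frobenius X i v ∈ V) :
    V ≤ E.frobIntegralPart X i 0 ↔ Module.End.IsSemisimple ((E.frobenius X i).restrict hV) := by
  by_cases hi : i ≤ 2 * d
  · obtain ⟨P, hP, -⟩ := hRH
    exact E.le_frobIntegralPart_zero_iff hX (hP ⟨i, by omega⟩) hV
  · refine ⟨fun h ↦ E.isSemisimple_restrict_of_le_frobIntegralPart hX h hV, fun _ ↦ ?_⟩
    rw [E.frobIntegralPart_eq_top_of_lt hX (by omega) 0]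
    exact le_top

end GaloisWeilCohomology

end Literature.AlgebraicGeometry.Motives

end
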